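import Literature.AlgebraicGeometry.Resolution.HuGammaSchemeResolution
import HarnessLib

/-!
# The complete quadrilateral in Hu's family: minors and evaluation maps (crux `UniversalCells.MatroidCellRes`)

Support for crux stmt-ResolutionOfSingularities-15230
(`Summit.ResolutionOfSingularities.ResolutionOfSingularities.Theses.UniversalCells.MatroidCellRes`),
line `birth`: the first of three files exhibiting a WITNESS for the hypotheses of the line's residue
stub (N) `stub_saturatedEngineNonintegral` — a singular saturated integral principal affine chart,
of dimension `6`, of a NON-integral Γ-scheme — so that Hu's Thm. 1.3 as PRINTED (integral Γ-schemes
only) provably does not cover every chart the crux needs (file `…ResidueWitness.lean`).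

The configuration is the COMPLETE QUADRILATERAL on `7` points over a field `K` with `2 ≠ 0`: the
frame `e₀, e₁, e₂`, `c₀ = (1,1,1)` and the three diagonal points `c₁ = (1,1,0)`, `c₂ = (1,0,1)`,
`c₃ = (0,1,1)`, i.e. the `3 × 4` matrix `A₀ = [[1,1,1,0],[1,1,0,1],[1,0,1,1]]` in the chart `[I₃ | A]`
of `Gr(3,7)` (`m = 4`). Its matroid has exactly six `3`-point lines
`{e₂,c₀,c₁}, {e₁,c₀,c₂}, {e₀,c₀,c₃}, {e₀,e₁,c₁}, {e₀,e₂,c₂}, {e₁,e₂,c₃}` (the diagonal points are NOT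
collinear as `2 ≠ 0`), and `Γ := {u | x_u(A₀) = 0}` (its non-bases, with all orderings and all
degenerate triples) is the saturated set of the chart studied in the sequel. This file is the
bookkeeping over Hu's minors `HuGamma.minor K 4 u` (Literature, `[I₃ | A]` model):

* the seven minors that matter, as polynomials (`minor_l₁` … `minor_l₆`, `minor_e₁e₂c₀`);
* `int_det_cols_A₀`, `aeval_minor_A₀_eq_zero` — CLASSIFICATION of `Γ`: `x_u(A₀) = 0` only if `u`
  repeats a column or is an ordering of one of the six lines (a finite computation, done over `ℤ` by
  `decide +kernel` and transported: all `x_u(A₀) ∈ {0, ±1, ±2}`, so `2 ≠ 0` is where it is used);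
* `aeval_minor_eq_zero_of_lines` — an evaluation `K[A] → S` that kills the six line minors kills
  every minor indexed by `Γ` (alternating in the columns: `Matrix.det_permute'`,
  `Matrix.det_zero_of_column_eq`);
* `exists_ringHom_gammaRing`, `exists_ringHom_away` — hence it factors through the Γ-ring
  `HuGamma.ring K 4 Γ = K[A] ⧸ (x_u : u ∈ Γ)` and, if it makes `a₀₀` a unit, through the chart ring
  `(K[A] ⧸ (x_u : u ∈ Γ))[1/a₀₀]`.

No definition and no notation is declared (points and lines are written out). Folklore throughout.
-/

noncomputable section

-- single-problem summit: the doubled namespace component `ResolutionOfSingularities` is forced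
set_option linter.dupNamespace false

open MvPolynomial Literature.AlgebraicGeometry.Resolution

namespace Summit.ResolutionOfSingularities.ResolutionOfSingularities.Theorems.MatroidCellRes

variable {K : Type} [Field K]

/-! ## The seven minors as polynomials -/

/-- `x_{(e₂,c₀,c₁)} = a₀₀a₁₁ - a₀₁a₁₀` (line `{e₂, c₀, c₁}`: `c₀, c₁` coplanar with `e₂`). [folklore] -/
theorem minor_l₁ : HuGamma.minor K 4 ![Sum.inl 2, Sum.inr 0, Sum.inr 1] =
    X (0, 0) * X (1, 1) - X (0, 1) * X (1, 0) := by
  unfold HuGamma.minor HuGamma.frameMatrix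
  simp [Matrix.det_fin_three, Matrix.submatrix_apply, Matrix.fromCols_apply_inl,
    Matrix.fromCols_apply_inr]

/-- `x_{(e₁,c₀,c₂)} = a₀₂a₂₀ - a₀₀a₂₂` (line `{e₁, c₀, c₂}`). [folklore] -/
theorem minor_l₂ : HuGamma.minor K 4 ![Sum.inl 1, Sum.inr 0, Sum.inr 2] =
    X (0, 2) * X (2, 0) - X (0, 0) * X (2, 2) := by
  unfold HuGamma.minor HuGamma.frameMatrix
  simp [Matrix.det_fin_three, Matrix.submatrix_apply, Matrix.fromCols_apply_inl,
    Matrix.fromCols_apply_inr]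
  ring

/-- `x_{(e₀,c₀,c₃)} = a₁₀a₂₃ - a₁₃a₂₀` (line `{e₀, c₀, c₃}`; the quadric cone of the chart). [folklore] -/
theorem minor_l₃ : HuGamma.minor K 4 ![Sum.inl 0, Sum.inr 0, Sum.inr 3] =
    X (1, 0) * X (2, 3) - X (1, 3) * X (2, 0) := by
  unfold HuGamma.minor HuGamma.frameMatrix
  simp [Matrix.det_fin_three, Matrix.submatrix_apply, Matrix.fromCols_apply_inl,
    Matrix.fromCols_apply_inr]

/-- `x_{(e₀,e₁,c₁)} = a₂₁` (line `{e₀, e₁, c₁}`: `c₁` on the line `e₀e₁`). [folklore] -/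
theorem minor_l₄ : HuGamma.minor K 4 ![Sum.inl 0, Sum.inl 1, Sum.inr 1] = X (2, 1) := by
  unfold HuGamma.minor HuGamma.frameMatrix
  simp [Matrix.det_fin_three, Matrix.submatrix_apply, Matrix.fromCols_apply_inl,
    Matrix.fromCols_apply_inr]

/-- `x_{(e₀,e₂,c₂)} = -a₁₂` (line `{e₀, e₂, c₂}`). [folklore] -/
theorem minor_l₅ : HuGamma.minor K 4 ![Sum.inl 0, Sum.inl 2, Sum.inr 2] = -X (1, 2) := by
  unfold HuGamma.minor HuGamma.frameMatrix
  simp [Matrix.det_fin_three, Matrix.submatrix_apply, Matrix.fromCols_apply_inl,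
    Matrix.fromCols_apply_inr]

/-- `x_{(e₁,e₂,c₃)} = a₀₃` (line `{e₁, e₂, c₃}`). [folklore] -/
theorem minor_l₆ : HuGamma.minor K 4 ![Sum.inl 1, Sum.inl 2, Sum.inr 3] = X (0, 3) := by
  unfold HuGamma.minor HuGamma.frameMatrix
  simp [Matrix.det_fin_three, Matrix.submatrix_apply, Matrix.fromCols_apply_inl,
    Matrix.fromCols_apply_inr]

/-- `x_{(e₁,e₂,c₀)} = a₀₀` (the chart will be `D(a₀₀)`). [folklore] -/
theorem minor_e₁e₂c₀ : HuGamma.minor K 4 ![Sum.inl 1, Sum.inl 2, Sum.inr 0] = X (0, 0) := by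
  unfold HuGamma.minor HuGamma.frameMatrix
  simp [Matrix.det_fin_three, Matrix.submatrix_apply, Matrix.fromCols_apply_inl,
    Matrix.fromCols_apply_inr]


/-! ## Evaluating a minor at a point: the columns of `[I₃ | P]` -/

/-- Evaluating the minor `x_u` of `[I₃ | A]` at a point `A ↦ P` (entries in a commutative
`K`-algebra `S`) gives the determinant of the three columns `u 0, u 1, u 2` of the matrix
`[I₃ | P]`. [folklore] -/
theorem aeval_minor {S : Type*} [CommRing S] [Algebra K S] (P : Fin 3 → Fin 4 → S)
    (u : Fin 3 → Fin 3 ⊕ Fin 4) :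
    aeval (fun ij : Fin 3 × Fin 4 => P ij.1 ij.2) (HuGamma.minor K 4 u) =
      (Matrix.of fun i k => Sum.elim (fun (i' : Fin 3) (i : Fin 3) => if i = i' then (1 : S) else 0)
        (fun (j : Fin 4) (i : Fin 3) => P i j) (u k) i).det := by
  unfold HuGamma.minor HuGamma.frameMatrix
  rw [AlgHom.map_det]
  congr 1
  ext i k
  simp only [AlgHom.mapMatrix_apply, Matrix.map_apply, Matrix.submatrix_apply, id_eq,
    Matrix.of_apply]
  cases u k with
  | inl i' => simp [Matrix.fromCols_apply_inl, Matrix.one_apply]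
  | inr j => simp [Matrix.fromCols_apply_inr]

/-- Permuting the column triple multiplies the minor by the sign of the permutation. [folklore] -/
theorem minor_comp_perm (m : ℕ) (u : Fin 3 → Fin 3 ⊕ Fin m) (σ : Equiv.Perm (Fin 3)) :
    HuGamma.minor K m (u ∘ σ) = Equiv.Perm.sign σ * HuGamma.minor K m u := by
  unfold HuGamma.minor
  rw [← Matrix.det_permute', Matrix.submatrix_submatrix]
  rfl

/-- A column triple with a repeated column has minor `0`. [folklore] -/
theorem minor_eq_zero_of_eq (m : ℕ) (u : Fin 3 → Fin 3 ⊕ Fin m) {k k' : Fin 3} (hk : k ≠ k')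
    (h : u k = u k') : HuGamma.minor K m u = 0 := by
  unfold HuGamma.minor
  exact Matrix.det_zero_of_column_eq hk (fun i => by simp [Matrix.submatrix_apply, h])

/-! ## Classification of the non-bases of the complete quadrilateral `A₀` -/

/-- Over `ℤ`: the determinant of three columns of `[I₃ | A₀]`, `A₀ = [[1,1,1,0],[1,1,0,1],[1,0,1,1]]`,
lies in `{0, ±1, ±2}`, and it vanishes only for a repeated column or an ordering of one of the six
lines. A finite check (`decide`). [folklore] -/
theorem int_det_cols_A₀ (u : Fin 3 → Fin 3 ⊕ Fin 4) :
    let c : Fin 3 ⊕ Fin 4 → Fin 3 → ℤ :=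
      Sum.elim (fun (i' : Fin 3) (i : Fin 3) => if i = i' then (1 : ℤ) else 0)
        (fun (j : Fin 4) (i : Fin 3) =>
          (![![(1 : ℤ), 1, 1, 0], ![1, 1, 0, 1], ![1, 0, 1, 1]] : Fin 3 → Fin 4 → ℤ) i j)
    let d : ℤ :=
      c (u 0) 0 * (c (u 1) 1 * c (u 2) 2 - c (u 2) 1 * c (u 1) 2)
        - c (u 1) 0 * (c (u 0) 1 * c (u 2) 2 - c (u 2) 1 * c (u 0) 2)
        + c (u 2) 0 * (c (u 0) 1 * c (u 1) 2 - c (u 1) 1 * c (u 0) 2)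
    (d = 0 ∨ d = 1 ∨ d = -1 ∨ d = 2 ∨ d = -2) ∧
      (d = 0 → (u 0 = u 1 ∨ u 0 = u 2 ∨ u 1 = u 2) ∨
        ∃ σ : Equiv.Perm (Fin 3),
          u = ![Sum.inl 2, Sum.inr 0, Sum.inr 1] ∘ σ ∨ u = ![Sum.inl 1, Sum.inr 0, Sum.inr 2] ∘ σ ∨
          u = ![Sum.inl 0, Sum.inr 0, Sum.inr 3] ∘ σ ∨ u = ![Sum.inl 0, Sum.inl 1, Sum.inr 1] ∘ σ ∨
          u = ![Sum.inl 0, Sum.inl 2, Sum.inr 2] ∘ σ ∨ u = ![Sum.inl 1, Sum.inl 2, Sum.inr 3] ∘ σ) := by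
  revert u
  decide +kernel

/-- **Classification of `Γ = {u | x_u(A₀) = 0}` over a field with `2 ≠ 0`**: a column triple whose
minor vanishes at the complete quadrilateral `A₀ = [[1,1,1,0],[1,1,0,1],[1,0,1,1]]` repeats a column
or is an ordering of one of the six lines `{e₂,c₀,c₁}, {e₁,c₀,c₂}, {e₀,c₀,c₃}, {e₀,e₁,c₁}, {e₀,e₂,c₂},
{e₁,e₂,c₃}` (the other minors are `±1, ±2 ≠ 0`). [folklore] -/
theorem aeval_minor_A₀_eq_zero (h2 : (2 : K) ≠ 0) (u : Fin 3 → Fin 3 ⊕ Fin 4)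
    (hu : aeval (fun ij : Fin 3 × Fin 4 =>
        (![![(1 : K), 1, 1, 0], ![1, 1, 0, 1], ![1, 0, 1, 1]] : Fin 3 → Fin 4 → K) ij.1 ij.2) (HuGamma.minor K 4 u) = 0) :
    (u 0 = u 1 ∨ u 0 = u 2 ∨ u 1 = u 2) ∨
      ∃ σ : Equiv.Perm (Fin 3),
        u = ![Sum.inl 2, Sum.inr 0, Sum.inr 1] ∘ σ ∨ u = ![Sum.inl 1, Sum.inr 0, Sum.inr 2] ∘ σ ∨
        u = ![Sum.inl 0, Sum.inr 0, Sum.inr 3] ∘ σ ∨ u = ![Sum.inl 0, Sum.inl 1, Sum.inr 1] ∘ σ ∨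
        u = ![Sum.inl 0, Sum.inl 2, Sum.inr 2] ∘ σ ∨ u = ![Sum.inl 1, Sum.inl 2, Sum.inr 3] ∘ σ := by
  have H := int_det_cols_A₀ u
  dsimp only at H
  obtain ⟨hv, hz⟩ := H
  apply hz
  -- the minor at `A₀` over `K` is the cast of the integer determinant
  have hc : ∀ (x : Fin 3 ⊕ Fin 4) (i : Fin 3),
      Sum.elim (fun (i' : Fin 3) (i : Fin 3) => if i = i' then (1 : K) else 0)
        (fun (j : Fin 4) (i : Fin 3) =>
          (![![(1 : K), 1, 1, 0], ![1, 1, 0, 1], ![1, 0, 1, 1]] : Fin 3 → Fin 4 → K) i j) x i =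
      ((Sum.elim (fun (i' : Fin 3) (i : Fin 3) => if i = i' then (1 : ℤ) else 0)
        (fun (j : Fin 4) (i : Fin 3) =>
          (![![(1 : ℤ), 1, 1, 0], ![1, 1, 0, 1], ![1, 0, 1, 1]] : Fin 3 → Fin 4 → ℤ) i j) x i : ℤ) : K) := by
    rintro (i' | j) i
    · simp [Int.cast_ite]
    · fin_cases i <;> fin_cases j <;> simp
  have key := hu
  rw [aeval_minor, Matrix.det_fin_three] at key
  simp only [Matrix.of_apply, hc] at key
  rcases hv with h0 | h1 | h1 | h1 | h1
  · exact h0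
  all_goals
    exfalso
    have h1K := congrArg (Int.cast : ℤ → K) h1
    push_cast at h1K
  · exact one_ne_zero (by linear_combination key - h1K : (1 : K) = 0)
  · exact one_ne_zero (by linear_combination h1K - key : (1 : K) = 0)
  · exact h2 (by linear_combination key - h1K)
  · exact h2 (by linear_combination h1K - key)

/-! ## Evaluations killing the six line minors kill every minor indexed by `Γ` -/

/-- **An evaluation `K[A] → S`, `A ↦ P`, at which the six line minors of the complete
quadrilateral vanish kills every minor `x_u`, `u ∈ Γ = {u | x_u(A₀) = 0}`**: by the classification,
`u` repeats a column (alternating) or is an ordering of a line (`x_{l∘σ} = sign σ · x_l`).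
[folklore] -/
theorem aeval_minor_eq_zero_of_lines {S : Type*} [CommRing S] [Algebra K S] (h2 : (2 : K) ≠ 0)
    (P : Fin 3 → Fin 4 → S)
    (l₁ : P 0 0 * P 1 1 - P 0 1 * P 1 0 = 0) (l₂ : P 0 2 * P 2 0 - P 0 0 * P 2 2 = 0)
    (l₃ : P 1 0 * P 2 3 - P 1 3 * P 2 0 = 0) (l₄ : P 2 1 = 0) (l₅ : P 1 2 = 0) (l₆ : P 0 3 = 0)
    (u : Fin 3 → Fin 3 ⊕ Fin 4)
    (hu : aeval (fun ij : Fin 3 × Fin 4 =>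
        (![![(1 : K), 1, 1, 0], ![1, 1, 0, 1], ![1, 0, 1, 1]] : Fin 3 → Fin 4 → K) ij.1 ij.2) (HuGamma.minor K 4 u) = 0) :
    aeval (fun ij : Fin 3 × Fin 4 => P ij.1 ij.2) (HuGamma.minor K 4 u) = 0 := by
  rcases aeval_minor_A₀_eq_zero h2 u hu with (h | h | h) | ⟨σ, h | h | h | h | h | h⟩
  · rw [minor_eq_zero_of_eq 4 u (show (0 : Fin 3) ≠ 1 by decide) h, map_zero]
  · rw [minor_eq_zero_of_eq 4 u (show (0 : Fin 3) ≠ 2 by decide) h, map_zero]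
  · rw [minor_eq_zero_of_eq 4 u (show (1 : Fin 3) ≠ 2 by decide) h, map_zero]
  all_goals
    subst h
    rw [minor_comp_perm, map_mul, map_intCast]
  · rw [minor_l₁]; simp only [map_sub, map_mul, aeval_X]; rw [l₁, mul_zero]
  · rw [minor_l₂]; simp only [map_sub, map_mul, aeval_X]; rw [l₂, mul_zero]
  · rw [minor_l₃]; simp only [map_sub, map_mul, aeval_X]; rw [l₃, mul_zero]
  · rw [minor_l₄]; simp only [aeval_X]; rw [l₄, mul_zero]
  · rw [minor_l₅]; simp only [map_neg, aeval_X]; rw [l₅, neg_zero, mul_zero]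
  · rw [minor_l₆]; simp only [aeval_X]; rw [l₆, mul_zero]

/-- **Factorisation through the Γ-ring.** Such an evaluation factors through
`HuGamma.ring K 4 Γ = K[A] ⧸ (x_u : u ∈ Γ)`, `Γ = {u | x_u(A₀) = 0}`. [folklore] -/
theorem exists_ringHom_gammaRing {S : Type*} [CommRing S] [Algebra K S] (h2 : (2 : K) ≠ 0)
    (P : Fin 3 → Fin 4 → S)
    (l₁ : P 0 0 * P 1 1 - P 0 1 * P 1 0 = 0) (l₂ : P 0 2 * P 2 0 - P 0 0 * P 2 2 = 0)
    (l₃ : P 1 0 * P 2 3 - P 1 3 * P 2 0 = 0) (l₄ : P 2 1 = 0) (l₅ : P 1 2 = 0) (l₆ : P 0 3 = 0) :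
    ∃ φ : HuGamma.ring K 4 {u | aeval (fun ij : Fin 3 × Fin 4 =>
        (![![(1 : K), 1, 1, 0], ![1, 1, 0, 1], ![1, 0, 1, 1]] : Fin 3 → Fin 4 → K) ij.1 ij.2) (HuGamma.minor K 4 u) = 0} →+* S,
      ∀ f, φ (Ideal.Quotient.mk _ f) = aeval (fun ij : Fin 3 × Fin 4 => P ij.1 ij.2) f := by
  have hker : ∀ f ∈ HuGamma.ideal K 4 {u | aeval (fun ij : Fin 3 × Fin 4 =>
        (![![(1 : K), 1, 1, 0], ![1, 1, 0, 1], ![1, 0, 1, 1]] : Fin 3 → Fin 4 → K) ij.1 ij.2) (HuGamma.minor K 4 u) = 0},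
      (aeval (fun ij : Fin 3 × Fin 4 => P ij.1 ij.2) :
        MvPolynomial (Fin 3 × Fin 4) K →ₐ[K] S).toRingHom f = 0 := by
    have hle : HuGamma.ideal K 4 {u | aeval (fun ij : Fin 3 × Fin 4 =>
        (![![(1 : K), 1, 1, 0], ![1, 1, 0, 1], ![1, 0, 1, 1]] : Fin 3 → Fin 4 → K) ij.1 ij.2) (HuGamma.minor K 4 u) = 0} ≤
        RingHom.ker (aeval (fun ij : Fin 3 × Fin 4 => P ij.1 ij.2) :
          MvPolynomial (Fin 3 × Fin 4) K →ₐ[K] S).toRingHom := by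
      unfold HuGamma.ideal
      refine Ideal.span_le.mpr ?_
      rintro _ ⟨u, hu, rfl⟩
      exact aeval_minor_eq_zero_of_lines h2 P l₁ l₂ l₃ l₄ l₅ l₆ u hu
    exact fun f hf => hle hf
  exact ⟨Ideal.Quotient.lift _ _ hker, fun f => Ideal.Quotient.lift_mk _ _ hker⟩

/-- **Factorisation through the chart ring.** If moreover `P₀₀` is a unit, the evaluation factors
through `(K[A] ⧸ (x_u : u ∈ Γ))[1/a₀₀]`. [folklore] -/
theorem exists_ringHom_away {S : Type*} [CommRing S] [Algebra K S] (h2 : (2 : K) ≠ 0)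
    (P : Fin 3 → Fin 4 → S)
    (l₁ : P 0 0 * P 1 1 - P 0 1 * P 1 0 = 0) (l₂ : P 0 2 * P 2 0 - P 0 0 * P 2 2 = 0)
    (l₃ : P 1 0 * P 2 3 - P 1 3 * P 2 0 = 0) (l₄ : P 2 1 = 0) (l₅ : P 1 2 = 0) (l₆ : P 0 3 = 0)
    (h00 : IsUnit (P 0 0)) :
    ∃ ψ : Localization.Away (Ideal.Quotient.mk
        (HuGamma.ideal K 4 {u | aeval (fun ij : Fin 3 × Fin 4 =>
        (![![(1 : K), 1, 1, 0], ![1, 1, 0, 1], ![1, 0, 1, 1]] : Fin 3 → Fin 4 → K) ij.1 ij.2) (HuGamma.minor K 4 u) = 0}) (X (0, 0))) →+* S,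
      ∀ f, ψ (algebraMap (HuGamma.ring K 4 {u | aeval (fun ij : Fin 3 × Fin 4 =>
        (![![(1 : K), 1, 1, 0], ![1, 1, 0, 1], ![1, 0, 1, 1]] : Fin 3 → Fin 4 → K) ij.1 ij.2)
          (HuGamma.minor K 4 u) = 0}) _ (Ideal.Quotient.mk _ f)) =
        aeval (fun ij : Fin 3 × Fin 4 => P ij.1 ij.2) f := by
  obtain ⟨φ, hφ⟩ := exists_ringHom_gammaRing h2 P l₁ l₂ l₃ l₄ l₅ l₆
  have hunit : IsUnit (φ (Ideal.Quotient.mk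
      (HuGamma.ideal K 4 {u | aeval (fun ij : Fin 3 × Fin 4 =>
        (![![(1 : K), 1, 1, 0], ![1, 1, 0, 1], ![1, 0, 1, 1]] : Fin 3 → Fin 4 → K) ij.1 ij.2) (HuGamma.minor K 4 u) = 0}) (X (0, 0)))) := by
    rw [hφ, aeval_X]
    exact h00
  exact ⟨IsLocalization.Away.lift _ hunit, fun f => by rw [IsLocalization.Away.lift_eq, hφ]⟩

end Summit.ResolutionOfSingularities.ResolutionOfSingularities.Theorems.MatroidCellRes

end
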